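import Literature.Analysis.Complex.JensenCircles
import Summits.RiemannHypothesis.RiemannHypothesis.Theorems.TiltedLandingLaw421StubAnalyticHeredity

/-!
# Helper: `offJensenSign_holds : OffJensenSignSig` for crux stmt-RiemannHypothesis-24774

Proof ported from C3 rh-idea-3 g20 rev 3 (89aa61df) under token-identical definitions.
The off-disc sign clause of Jensen 1913 / Kim 1996 (2.3): if `p` lies strictly outside every
closed Jensen disc of a class function `g`, then `Im (g′/g)(p) < 0`.

Sources: Jensen 1913 via Kim–Kim 1996 (2.3) (critic PASS(M, in print)).
This file lands `--supports stmt-RiemannHypothesis-24774`; the skeleton's window half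
`windowSig_OKBox` consumes this via `sign_of_boundaryOK`.
-/

open Complex Metric
open scoped ComplexConjugate

/-! ## §1 TOKEN-IDENTICAL copies of skeleton definitions -/

namespace StubOffJensenSign

/-- TOKEN-IDENTICAL copy of `RhIdea6.G18.W07C8.Law421BirthS.InClass` (skeleton l.1117-1120). -/
def InClass (g : ℂ → ℂ) (Hs : ℝ) : Prop :=
  Differentiable ℂ g ∧ (∀ t : ℝ, (g (t : ℂ)).im = 0) ∧
    (∃ A' B' ρ : ℝ, ρ < 2 ∧ ∀ z : ℂ, ‖g z‖ ≤ A' * Real.exp (B' * ‖z‖ ^ ρ)) ∧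
    (∀ w : ℂ, g w = 0 → |w.im| ≤ Hs)

/-- TOKEN-IDENTICAL copy of `RhIdea6.G18.W07C8.Law421BirthS.OffJensenDiscs` (skeleton l.1123-1124). -/
def OffJensenDiscs (g : ℂ → ℂ) (p : ℂ) : Prop :=
  ∀ u : ℂ, g u = 0 → u.im ≠ 0 → u.im ^ 2 < (p.re - u.re) ^ 2 + p.im ^ 2

/-- TOKEN-IDENTICAL copy of `RhIdea6.G18.W07C8.Law421BirthS.OffJensenSignSig` (skeleton l.1160-1161). -/
def OffJensenSignSig : Prop := ∀ (g : ℂ → ℂ) (Hs : ℝ) (p : ℂ),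
  InClass g Hs → g ≠ 0 → (∃ u : ℂ, g u = 0) → 0 < p.im → OffJensenDiscs g p → (deriv g p / g p).im < 0

/-! ## §2 The proof (from C3 rev3 offJensenSign) -/

open Literature.Analysis.Complex

/-- **PROVED.** The off-disc sign: if `p` with `Im p > 0` lies outside every closed Jensen disc
of a class function `g`, then `Im (g′/g)(p) < 0`. -/
theorem offJensenSign : OffJensenSignSig := by
  classical
  intro f Hs p hcl hne hex hp hoff
  obtain ⟨hf, hreal, hgr0, -⟩ := hcl
  obtain ⟨ρ, C, hρ0, hρ, -, hgr⟩ := StubAnalyticHeredity.growth_treeForm hf hgr0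
  -- every zero `a` of `f` has `|Im a| < ‖p - Re a‖`
  have hcon : ∀ a, f a = 0 → |a.im| < ‖p - (a.re : ℂ)‖ := by
    intro a ha
    have h3 : ‖p - (a.re : ℂ)‖ ^ 2 = (p.re - a.re) ^ 2 + p.im ^ 2 := by
      rw [← Complex.normSq_eq_norm_sq, Complex.normSq_apply]; simp; ring
    have hsq : |a.im| ^ 2 < ‖p - (a.re : ℂ)‖ ^ 2 := by
      rw [sq_abs, h3]
      by_cases haim : a.im = 0
      · rw [haim]; nlinarith [sq_nonneg (p.re - a.re)]
      · exact hoff a ha haim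
    exact lt_of_pow_lt_pow_left₀ 2 (norm_nonneg _) hsq
  -- `f p ≠ 0`
  have hfp : f p ≠ 0 := by
    intro h0
    have h := hcon p h0
    have e : p - (p.re : ℂ) = (p.im : ℂ) * I := by apply Complex.ext <;> simp
    rw [e, norm_mul, Complex.norm_I, mul_one, Complex.norm_real, Real.norm_eq_abs] at h
    exact lt_irrefl _ h
  have hfp' : f (conj p) ≠ 0 := by
    rw [apply_conj_eq_conj hf hreal, map_ne_zero]; exact hfp
  have hpim : p.im ≠ 0 := hp.ne'
  obtain ⟨a₀, ha₀⟩ := hex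
  obtain ⟨c, hc⟩ := exists_ofReal_ne_zero hf ⟨p, hfp⟩
  obtain ⟨-, hκ⟩ := im_mul_im_pair_le (hcon a₀ ha₀) hpim (le_refl 1)
  set κ : ℝ := 2 * p.im ^ 2 * (‖p - a₀.re‖ ^ 2 - a₀.im ^ 2) /
    (‖p - a₀‖ ^ 2 * ‖p - conj a₀‖ ^ 2) with hκdef
  have hε : 0 < κ / (|p.im| + 1) := by positivity
  obtain ⟨S, m, ψ₁, ψ₂, hS, hS', h1, h2, hψ⟩ :=
    exists_logDeriv_eq_sum_pair hf hρ0 hρ hgr hc hfp hfp' ‖a₀ - c‖ hε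
  have ha₀S : a₀ ∈ S := hS' a₀ ha₀ le_rfl
  rw [logDeriv_apply_conj hf hreal] at h2
  set L : ℂ := deriv f p / f p with hLdef
  -- conjugate the second expansion: `L = ∑ m(a)/(p - ā) + conj ψ₂`
  have h2' : L = ∑ a ∈ S, (m a : ℂ) / (p - conj a) + conj ψ₂ := by
    have := congrArg conj h2
    rw [Complex.conj_conj, map_add, map_sum] at this
    rw [this]
    congr 1
    refine Finset.sum_congr rfl fun a _ ↦ ?_
    rw [map_div₀, map_natCast, map_sub, Complex.conj_conj]
  have hsum : ∑ a ∈ S, p.im * ((m a : ℂ) / (p - a) + (m a : ℂ) / (p - conj a)).im =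
      p.im * (L.im + L.im - ψ₁.im + ψ₂.im) := by
    have e : ∑ a ∈ S, ((m a : ℂ) / (p - a) + (m a : ℂ) / (p - conj a)) =
        L + L - ψ₁ - conj ψ₂ := by
      rw [Finset.sum_add_distrib]
      have e1 : ∑ a ∈ S, (m a : ℂ) / (p - a) = L - ψ₁ := eq_sub_of_add_eq h1.symm
      have e2 : ∑ a ∈ S, (m a : ℂ) / (p - conj a) = L - conj ψ₂ := eq_sub_of_add_eq h2'.symm
      rw [e1, e2]; ring
    rw [← Finset.mul_sum, ← Complex.im_sum, e]
    simp only [Complex.sub_im, Complex.add_im, Complex.conj_im]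
    ring
  have hle : ∑ a ∈ S, p.im * ((m a : ℂ) / (p - a) + (m a : ℂ) / (p - conj a)).im ≤ -κ := by
    rw [← Finset.add_sum_erase S _ ha₀S]
    have hrest : ∑ a ∈ S.erase a₀, p.im * ((m a : ℂ) / (p - a) + (m a : ℂ) / (p - conj a)).im
        ≤ 0 :=
      Finset.sum_nonpos fun a ha ↦
        im_mul_im_pair_nonpos (hcon a (hS a (Finset.mem_of_mem_erase ha)).1) (m a)
    have hfirst := (im_mul_im_pair_le (hcon a₀ ha₀) hpim (hS a₀ ha₀S).2).1
    rw [← hκdef] at hfirst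
    linarith
  have hψim : |ψ₂.im - ψ₁.im| ≤ κ / (|p.im| + 1) := by
    calc |ψ₂.im - ψ₁.im| = |(ψ₁ - ψ₂).im| := by rw [Complex.sub_im, abs_sub_comm]
      _ ≤ ‖ψ₁ - ψ₂‖ := Complex.abs_im_le_norm _
      _ ≤ κ / (|p.im| + 1) := hψ
  have hprod : |p.im * (ψ₂.im - ψ₁.im)| ≤ |p.im| * (κ / (|p.im| + 1)) := by
    rw [abs_mul]; exact mul_le_mul_of_nonneg_left hψim (abs_nonneg _)
  have hlt : |p.im| * (κ / (|p.im| + 1)) < κ := by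
    rw [← mul_div_assoc, div_lt_iff₀ (by positivity)]
    nlinarith [abs_nonneg p.im]
  have hneg := neg_abs_le (p.im * (ψ₂.im - ψ₁.im))
  rw [hsum] at hle
  -- `2 · p.im · L.im < 0`, and `p.im > 0`
  have hx : p.im * (L.im + L.im) =
      p.im * (L.im + L.im - ψ₁.im + ψ₂.im) - p.im * (ψ₂.im - ψ₁.im) := by ring
  have h2L : p.im * (L.im + L.im) < 0 := by rw [hx]; linarith
  nlinarith [h2L, hp.le]

end StubOffJensenSign

/-! ## §4 Export -/

/-- **`offJensenSign_holds` PROVED.** Named for the skeleton's `OffJensenSignSig`. -/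
theorem offJensenSign_holds : StubOffJensenSign.OffJensenSignSig :=
  StubOffJensenSign.offJensenSign

#print axioms offJensenSign_holds
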